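import Summits.Ventures.HodgeRepro.FaceCensusEngine
import Summits.Ventures.HodgeRepro.EngineMasks
import Summits.Ventures.HodgeRepro.EngineFacesWF
import Summits.Ventures.HodgeRepro.EngineNormalize
import Summits.Ventures.HodgeRepro.EngineOrbits
import Summits.Ventures.HodgeRepro.EngineCounts
import Summits.Ventures.HodgeRepro.EngineTypes
import Summits.Ventures.HodgeRepro.EngineSquares

/-!
# FaceCensusStructural — the structural half of every census row from the group axioms alone (seat p4)

`structural_rows`: for any Cayley table `Γ` with `Γ.isCMGaloisType = true` and `n ≥ 5`, the numbers of CM types,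
places, faces and type squares are the closed formulas `2^{n/2}`, `n/2`, `2^{n/2}·(n/2)(n/2−1)`, `…/8`, and every
face satisfies `sumTwo`, `cornersWF`, `noConjugateCorners`.  No kernel computation.
-/

namespace Summit.Ventures.HodgeRepro.FaceCensus

namespace CMGaloisType

variable {n : ℕ} (Γ : CMGaloisType n)

/-- The structural half of every census row, from the group axioms alone (`n ≥ 5`). -/
theorem structural_rows (h : Γ.isCMGaloisType = true) (hn : 5 ≤ n) :
    (Γ.cmTypes.length = 2 ^ (n / 2) ∧ Γ.places.length = n / 2 ∧
      Γ.faces.length = 2 ^ (n / 2) * (n / 2 * (n / 2 - 1)) ∧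
      Γ.squares.length = 2 ^ (n / 2) * (n / 2 * (n / 2 - 1)) / 8) ∧
    Γ.faces.all Γ.sumTwo = true ∧ Γ.faces.all Γ.cornersWF = true ∧ Γ.faces.all Γ.noConjugateCorners = true := by
  have hΓ : Γ.isCMGaloisType = true := h
  refine ⟨⟨Γ.cmTypes_length hΓ, Γ.places_length hΓ, ?_, Γ.squares_length_eq hΓ⟩, ?_, ?_, ?_⟩
  · rw [Γ.faces_length, Γ.cmTypes_length hΓ, Γ.places_length hΓ]
  · exact List.all_eq_true.2 fun f hf => Γ.sumTwo_of_mem_faces hΓ hf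
  · exact List.all_eq_true.2 fun f hf => Γ.cornersWF_of_mem_faces hΓ (by omega) hf
  · exact List.all_eq_true.2 fun f hf => Γ.noConjugateCorners_of_mem_faces hΓ hn hf

end CMGaloisType

end Summit.Ventures.HodgeRepro.FaceCensus
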